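import Literature.AlgebraicGeometry.ModuliOfAbelianVarieties.Lan2013.Sec32BiextensionsCubical
import Literature.AlgebraicGeometry.Modules.PullbackTensor
import Literature.AlgebraicGeometry.Modules.PullbackDual
import Literature.AlgebraicGeometry.Modules.TensorBraiding
import Literature.AlgebraicGeometry.AbelianVarieties.StructureSheafSemiHomogeneous
import Literature.AlgebraicGeometry.AbelianVarieties.HomogeneousLineBundleDivisor
import HarnessLib

/-!
# [Lan2013] §3.2 — PROOF COMPANION of ★ `Lan2013/Sec32BiextensionsCubical.lean` (RULING TS-1: theorem-only)

Discharges the closed named facts ★ `Lan2013_3229` (Rem. 3.2.2.9 for `C = 𝔾_m`: the trivializations of a cubical torsor form a torsor under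
`Hom^{(2)}(G, 𝔾_m)`), which is formal once `D₃` is known to be FUNCTORIAL on isomorphisms: `D₃(f ≫ g) = D₃(f) ≫ D₃(g)` and `D₃(𝟙) = 𝟙`
(`D3mapIso_trans`, `D3mapIso_refl`, from the functoriality of `Scheme.Modules.pullback`, ★ `Modules.tensorMap_comp` ∕ `tensorMap_id` and ★
`Modules.sheafHomMapLeft_comp` ∕ `sheafHomMapLeft_id`), and (ED. 2) ★ `Lan2013_3221` (Lem. 3.2.2.1: the symmetry isomorphism `s^*D₂(L) ≅ D₂(L)`
over a commutative group object — from `s ≫ m = m` (Mathlib `IsCommMonObj.mul_comm`), `s ≫ pr₁ = pr₂`, `s ≫ pr₂ = pr₁`, the tree's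
monoidality of pull-back on vector bundles ★ `Modules.pullbackTensorIso` ∕ `pullbackDualIso`, Mathlib `Scheme.Modules.pullbackComp` ∕
`pullbackCongr`, and the braiding ★ `Modules.tensorComm`), and (ED. 3) ★ `Lan2013_3241` ((3.2.4.1): `K(L) = ker λ_L` is a closed subgroup scheme whose
points are [MFK]'s `K(L)` — closedness by ★ `GroupSchemeKernel.isClosedImmersion_kerι_left_of_isSeparated`; the points by
`(1 × (u ≫ λ))^*𝒫 ≅ (1 × u)^*Λ(L)`, the triviality of `Λ(L)` over the unit point (★ `kOfL`, `one_mem`), `1 ≫ λ = 1`, and the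
uniqueness half of the dual pair's universal property ★ `DualPair.eq_of_nonempty_iso` against the trivial rigidified family).
Theorems only: no `def`, no new fact, no `sorry`, no instance, no notation.  Cell hodgecm-mathlib, squad TS, typer TS-t09 (block R1b);
net debt −3.  HC_CM is proved only modulo the 7 printed citations (2 remaining:
hLiu418 = stmt-HodgeConjecture-24832, h413 = stmt-HodgeConjecture-24833) until rung 0 closes; this file is unrelated to them.

## References
* [Lan2013PELCompactifications] K.-W. Lan, *Arithmetic compactifications of PEL-type Shimura varieties*, LMS Monographs 36 (2013), Lem. 3.2.2.1
  (p. 157; 2010 rev. p. 176), Rem. 3.2.2.9 (p. 158; 2010 rev. p. 177), §3.2.4 (3.2.4.1) (p. 159; 2010 rev. p. 178).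
-/

noncomputable section

universe u

open CategoryTheory CategoryTheory.Limits AlgebraicGeometry MonoidalCategory CartesianMonoidalCategory
open Literature.AlgebraicGeometry.Modules
open Literature.AlgebraicGeometry.Motives
open Literature.AlgebraicGeometry.AbelianSchemes
open Literature.AlgebraicGeometry.AbelianVarieties
open Literature.AlgebraicGeometry.GroupSchemes

namespace Literature.AlgebraicGeometry.ModuliOfAbelianVarieties.Lan2013.Sec32BiextensionsCubical

open scoped MonObj

/-! ## Functoriality of the inverse (dual) and of `⊗` on isomorphisms -/

/-- `(f ≫ g)^∨ = f^∨ ≫ g^∨` on isomorphisms (contravariance of `𝓗om(−, 𝒪)` twice). [cite: Lan2013PELCompactifications, §3.2.2 (p. 157; 2010 rev. p. 175)] -/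
theorem dualMapIso_trans {X : Scheme.{u}} {L L' L'' : X.Modules} (f : L ≅ L') (g : L' ≅ L'') :
    dualMapIso (f ≪≫ g) = dualMapIso f ≪≫ dualMapIso g := by
  ext : 1
  simp only [dualMapIso, Iso.trans_hom, sheafHomMapLeftIso_hom, Iso.trans_inv, sheafHomMapLeft_comp]

/-- `(𝟙)^∨ = 𝟙`. [cite: Lan2013PELCompactifications, §3.2.2 (p. 157; 2010 rev. p. 175)] -/
theorem dualMapIso_refl {X : Scheme.{u}} (L : X.Modules) : dualMapIso (Iso.refl L) = Iso.refl _ := by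
  ext : 1
  simp only [dualMapIso, sheafHomMapLeftIso_hom, Iso.refl_inv, sheafHomMapLeft_id, Iso.refl_hom]

/-- `(e ≫ e') ⊗ (f ≫ f') = (e ⊗ f) ≫ (e' ⊗ f')` on isomorphisms (★ `tensorMap_comp`). [cite: Lan2013PELCompactifications, §3.2.2 (p. 157; 2010 rev. p. 175)] -/
theorem tensorMapIso_trans {X : Scheme.{u}} {M M' M'' N N' N'' : X.Modules} (e : M ≅ M') (e' : M' ≅ M'') (f : N ≅ N')
    (f' : N' ≅ N'') : tensorMapIso (e ≪≫ e') (f ≪≫ f') = tensorMapIso e f ≪≫ tensorMapIso e' f' := by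
  ext : 1
  simp only [tensorMapIso_hom, Iso.trans_hom, tensorMap_comp]

/-- `𝟙 ⊗ 𝟙 = 𝟙` on isomorphisms (★ `tensorMap_id`). [cite: Lan2013PELCompactifications, §3.2.2 (p. 157; 2010 rev. p. 175)] -/
theorem tensorMapIso_refl {X : Scheme.{u}} (M N : X.Modules) : tensorMapIso (Iso.refl M) (Iso.refl N) = Iso.refl _ := by
  ext : 1
  simp only [tensorMapIso_hom, Iso.refl_hom, tensorMap_id]

/-! ## Functoriality of `D₃` on isomorphisms -/

section DThree

variable {S : Scheme.{u}} (G : Over S) [GrpObj G]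

/-- **`D₃(f ≫ g) = D₃(f) ≫ D₃(g)`** («the same operations define morphisms `D₃(f)` for morphisms between `C`-torsors» — functorially).
[cite: Lan2013PELCompactifications, §3.2.2 (p. 157; 2010 rev. p. 175)] -/
theorem D3mapIso_trans {L L' L'' : G.left.Modules} (f : L ≅ L') (g : L' ≅ L'') :
    D3mapIso G (f ≪≫ g) = D3mapIso G f ≪≫ D3mapIso G g := by
  simp only [D3mapIso, Functor.mapIso_trans, dualMapIso_trans, tensorMapIso_trans]
  rfl

/-- **`D₃(𝟙_L) = 𝟙`.** [cite: Lan2013PELCompactifications, §3.2.2 (p. 157; 2010 rev. p. 175)] -/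
theorem D3mapIso_refl (L : G.left.Modules) : D3mapIso G (Iso.refl L) = Iso.refl _ := by
  simp only [D3mapIso, Functor.mapIso_refl, dualMapIso_refl, tensorMapIso_refl]
  rfl

end DThree

/-! ## Rem. 3.2.2.9 -/

/-- **Rem. 3.2.2.9 holds** (★ `Lan2013_3229`): for a trivialisation `σ` of `L` and any `τ₀`, (i) `σ ≫ ν` is again a trivialization of
`(L, D₃(σ) ≫ τ₀)` iff `D₃(ν) = 1` (`ν ∈ Hom^{(2)}(G, 𝔾_m)`), and (ii) any trivialization `σ′` of `(L, D₃(σ) ≫ τ₀)` is `σ ≫ ν` for such a `ν`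
(namely `ν = σ⁻¹ ≫ σ′`).  Formal from the functoriality of `D₃`. [cite: Lan2013PELCompactifications, Rem. 3.2.2.9 (p. 158; 2010 rev. p. 177)] -/
theorem Lan2013_3229_holds : Lan2013_3229 := by
  intro S G _ L _ τ₀ σ
  have cancel : ∀ (ν : SheafOfModules.unit (G.left).ringCatSheaf ≅ SheafOfModules.unit _),
      D3mapIso G (σ ≪≫ ν) ≪≫ τ₀ = D3mapIso G σ ≪≫ τ₀ ↔ D3mapIso G ν = Iso.refl _ := by
    intro ν
    rw [D3mapIso_trans, Iso.trans_assoc]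
    constructor
    · intro h
      have h' : D3mapIso G ν ≪≫ τ₀ = τ₀ := by
        simpa only [Iso.symm_self_id_assoc] using congrArg (fun e => (D3mapIso G σ).symm ≪≫ e) h
      have h'' := congrArg (fun e => e ≪≫ τ₀.symm) h'
      simpa only [Iso.trans_assoc, Iso.self_symm_id, Iso.trans_refl] using h''
    · intro h
      rw [h, Iso.refl_trans]
  refine ⟨fun ν => ?_, fun σ' hσ' => ?_⟩
  · rw [cancel ν]
    rfl
  · refine ⟨σ.symm ≪≫ σ', ?_, (Iso.self_symm_id_assoc σ σ').symm⟩
    show D3mapIso G (σ.symm ≪≫ σ') = Iso.refl _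
    have hD : D3mapIso G σ' = D3mapIso G σ := by
      have h'' := congrArg (fun e => e ≪≫ τ₀.symm) hσ'
      simpa only [Iso.trans_assoc, Iso.self_symm_id, Iso.trans_refl] using h''
    rw [D3mapIso_trans, hD, ← D3mapIso_trans, Iso.symm_self_id, D3mapIso_refl]

/-! ## Lem. 3.2.2.1 (ED. 2) -/

section SymmetryDTwo

variable {S : Scheme.{u}} (G : Over S)

/-- `s ≫ m = m` on underlying schemes, for a COMMUTATIVE group object (Mathlib `IsCommMonObj.mul_comm`).
[cite: Lan2013PELCompactifications, Lem. 3.2.2.1 (p. 157; 2010 rev. p. 176)] -/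
theorem braiding_left_comp_mul_left [GrpObj G] [IsCommMonObj G] : (β_ G G).hom.left ≫ (μ[G]).left = (μ[G]).left := by
  rw [← Over.comp_left, IsCommMonObj.mul_comm]

/-- `s ≫ pr₁ = pr₂` on underlying schemes. [cite: Lan2013PELCompactifications, Lem. 3.2.2.1 (p. 157; 2010 rev. p. 176)] -/
theorem braiding_left_comp_fst_left : (β_ G G).hom.left ≫ (fst G G).left = (snd G G).left := by
  rw [← Over.comp_left, braiding_hom_fst]

/-- `s ≫ pr₂ = pr₁` on underlying schemes. [cite: Lan2013PELCompactifications, Lem. 3.2.2.1 (p. 157; 2010 rev. p. 176)] -/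
theorem braiding_left_comp_snd_left : (β_ G G).hom.left ≫ (snd G G).left = (fst G G).left := by
  rw [← Over.comp_left, braiding_hom_snd]

end SymmetryDTwo

/-- **Lem. 3.2.2.1 holds** (★ `Lan2013_3221`): for an invertible sheaf `L` over a commutative group object `G`,
`s^*D₂(L) = s^*(m^*L ⊗ (pr₁^*L)^∨ ⊗ (pr₂^*L)^∨) ≅ (s ≫ m)^*L ⊗ ((s ≫ pr₁)^*L)^∨ ⊗ ((s ≫ pr₂)^*L)^∨ = m^*L ⊗ (pr₂^*L)^∨ ⊗ (pr₁^*L)^∨ ≅ D₂(L)`,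
the last step by the symmetry of `⊗`. [cite: Lan2013PELCompactifications, Lem. 3.2.2.1 (p. 157; 2010 rev. p. 176)] -/
theorem Lan2013_3221_holds : Lan2013_3221 := by
  intro S G _ _ L hL
  have hfl : ∀ {X : Over S} (f : X ⟶ G), IsFiniteLocallyFree (pb G f L) := fun f =>
    HasRank.isFiniteLocallyFree' (hasRank_pullback _ hL)
  have hfd : ∀ {X : Over S} (f : X ⟶ G), IsFiniteLocallyFree (Modules.dual (pb G f L)) := fun f =>
    HasRank.isFiniteLocallyFree' (hasRank_dual (hasRank_pullback _ hL))
  have hft : IsFiniteLocallyFree (tensorObj (Modules.dual (pb G (fst G G) L)) (Modules.dual (pb G (snd G G) L))) :=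
    HasRank.isFiniteLocallyFree'
      (hasRank_tensorObj_one (hasRank_dual (hasRank_pullback _ hL)) (hasRank_dual (hasRank_pullback _ hL)))
  let s := (β_ G G).hom.left
  let eA : (Scheme.Modules.pullback s).obj (pb G μ[G] L) ≅ pb G μ[G] L :=
    (Scheme.Modules.pullbackComp s (μ[G]).left).app L ≪≫
      (Scheme.Modules.pullbackCongr (braiding_left_comp_mul_left G)).app L
  let eB : (Scheme.Modules.pullback s).obj (Modules.dual (pb G (fst G G) L)) ≅ Modules.dual (pb G (snd G G) L) :=
    pullbackDualIso s (hfl (fst G G)) ≪≫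
      dualMapIso ((Scheme.Modules.pullbackComp s (fst G G).left).app L ≪≫
        (Scheme.Modules.pullbackCongr (braiding_left_comp_fst_left G)).app L)
  let eC : (Scheme.Modules.pullback s).obj (Modules.dual (pb G (snd G G) L)) ≅ Modules.dual (pb G (fst G G) L) :=
    pullbackDualIso s (hfl (snd G G)) ≪≫
      dualMapIso ((Scheme.Modules.pullbackComp s (snd G G).left).app L ≪≫
        (Scheme.Modules.pullbackCongr (braiding_left_comp_snd_left G)).app L)
  exact ⟨pullbackTensorIso s (hfl μ[G]) hft ≪≫
    tensorMapIso eA (pullbackTensorIso s (hfd (fst G G)) (hfd (snd G G)) ≪≫ tensorMapIso eB eC ≪≫ tensorComm _ _)⟩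

/-! ## (3.2.4.1) `K(L) = ker λ_L` (ED. 3) -/

/-- **(3.2.4.1) holds** (★ `Lan2013_3241`): for `λ` with `(1_A × λ)^*𝒫 ≅ Λ(L)` a homomorphism and `L` rigidified of rank one, `ker λ → A` is a
closed immersion (`A^∨ → S` is separated) and, for every `u : T → A`, `u ∈ K(L)(T)` iff `u ≫ λ = 1`: `(1 × (u ≫ λ))^*𝒫 ≅ (1 × u)^*Λ(L)`, the
unit point has `(1 × (1 ≫ λ))^*𝒫 ≅ (1 × 1)^*Λ(L) ≅ 𝒪` (rigidification), `1 ≫ λ = 1`, and two points classifying the trivial rigidified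
family coincide (★ `DualPair.eq_of_nonempty_iso`). [cite: Lan2013PELCompactifications, §3.2.4 (3.2.4.1) (p. 159; 2010 rev. p. 178)] -/
theorem Lan2013_3241_holds : Lan2013_3241 := by
  intro S A D L lam hL hε hlam
  obtain ⟨hmon, ⟨eΛ⟩⟩ := hlam
  haveI := hmon
  refine ⟨?_, fun T u => ?_⟩
  · haveI := D.hat.isProper
    exact GroupSchemeKernel.isClosedImmersion_kerι_left_of_isSeparated lam
  · -- `(1 × (w ≫ λ))^*𝒫 ≅ (1 × w)^*Λ(L)`
    have hcomp : ∀ w : T ⟶ A.X, Nonempty ((Scheme.Modules.pullback (A.X ◁ (w ≫ lam)).left).obj D.P ≅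
        (Scheme.Modules.pullback (A.X ◁ w).left).obj (A.mumfordBundle L)) := fun w =>
      ⟨(Scheme.Modules.pullbackCongr
            (show (A.X ◁ (w ≫ lam)).left = (A.X ◁ w).left ≫ (A.X ◁ lam).left by
              rw [MonoidalCategory.whiskerLeft_comp, Over.comp_left])).app D.P ≪≫
        ((Scheme.Modules.pullbackComp (A.X ◁ w).left (A.X ◁ lam).left).app D.P).symm ≪≫
        (Scheme.Modules.pullback (A.X ◁ w).left).mapIso eΛ⟩
    -- the unit point lies in `K(L)` (rigidification) and `1 ≫ λ = 1`
    have hε' := A.pullback_unitSection_detClass_eq_one hL hε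
    have hone : A.MemKOfL L (1 : T ⟶ A.X) := (A.mem_kOfL_iff hL hε' 1).1 (A.kOfL L hL hε' T).one_mem
    have h1lam : (1 : T ⟶ A.X) ≫ lam = 1 := (IsMonHom.monoidHom lam T).map_one
    -- the trivial rigidified family on `A_T`, fibrewise in `Pic⁰`
    let 𝒪T : A.RigidifiedLineBundle T.hom :=
      { L := SheafOfModules.unit _
        hasRank_one := hasRank_unit_one
        rigid := ⟨AbelianSchemeOver.RigidifiedLineBundle.pullbackUnitIso _⟩ }
    have h𝒪 : 𝒪T.FibrewisePicZero := fun Ω _ _ t =>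
      (isHomogeneous_iff_of_iso _ (AbelianSchemeOver.RigidifiedLineBundle.pullbackUnitIso _)).2 (isHomogeneous_unit _)
    have hP : ∀ c : T ⟶ D.hat.X,
        Nonempty ((Scheme.Modules.pullback (A.X ◁ c).left).obj D.P ≅ SheafOfModules.unit _) →
          Nonempty (D.pullbackP T.hom c.left (Over.w c) ≅ 𝒪T.L) := fun c h =>
      h.map fun i => (Scheme.Modules.pullbackCongr (A.baseChangeToProd_eq_whiskerLeft_left D.hat c)).app D.P ≪≫ i
    have hunit : Nonempty ((Scheme.Modules.pullback (A.X ◁ ((1 : T ⟶ A.X) ≫ lam)).left).obj D.P ≅ SheafOfModules.unit _) :=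
      hone.map fun i => (hcomp 1).some ≪≫ i
    constructor
    · intro hmem
      obtain ⟨i⟩ := hmem
      have hu : Nonempty ((Scheme.Modules.pullback (A.X ◁ (u ≫ lam)).left).obj D.P ≅ SheafOfModules.unit _) :=
        ⟨(hcomp u).some ≪≫ i⟩
      have heq := D.eq_of_nonempty_iso T.hom 𝒪T h𝒪 (u ≫ lam).left (((1 : T ⟶ A.X) ≫ lam)).left (Over.w _) (Over.w _)
        (hP _ hu) (hP _ hunit)
      rw [← h1lam]
      exact Over.OverMorphism.ext heq
    · intro hu
      have h' : u ≫ lam = (1 : T ⟶ A.X) ≫ lam := by rw [hu, h1lam]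
      obtain ⟨i⟩ := hunit
      rw [← h'] at i
      exact ⟨(hcomp u).some.symm ≪≫ i⟩

end Literature.AlgebraicGeometry.ModuliOfAbelianVarieties.Lan2013.Sec32BiextensionsCubical

end
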